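import Mathlib
import Literature.NumberTheory.LFunctions.PeriodicDirichletSeriesSmoothPartLimit
import Literature.NumberTheory.LFunctions.PeriodicDirichletSeriesAtOneDigamma
import Literature.NumberTheory.Transcendental.BakerBirchWirsingStepsProofs
import HarnessLib

/-!
# Okada's criterion for the vanishing of `Σ f(n)/n` (Okada 1982; Chatterjee–Murty 2014, Theorem 3)

Topic `Literature/NumberTheory/Transcendental`; namespace `Literature.NumberTheory.Transcendental.OkadaCriterion`.
THEOREMS only (no definition, no named fact, no `sorry`); cell pub-zeta5, P1 g58. The transcendence input is the
tree's PROVED Baker theorem (`baker_holds`), consumed through P1 g55's Baker–Birch–Wirsing steps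
(`BakerBirchWirsing.LFunction_one_twist_eq_zero`, `dft_relation_transport_unit`, `totient_mul_apply_eq`); the analytic
input is the `M(q)`-decomposition of `Literature/NumberTheory/LFunctions/PeriodicDirichletSeriesSmoothPart{,Limit}.lean`.

## Sources (read on the page)

* T. Chatterjee, M. Ram Murty, *Non-vanishing of Dirichlet series with periodic coefficients*, J. Number Theory
  **145** (2014) 1–21 [ChatterjeeMurty2014] (arXiv:1405.6982): §2.2 **Proposition 2** «In 1986 [sic], Okada [TO]
  proved a proposition about the non-vanishing of `L(1,f)` and Saradha and Tijdeman [ST] modified his proposition,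
  which we call Okada's criterion … Let the `q`-th cyclotomic polynomial `Φ_q` be irreducible over
  `ℚ(f(1),…,f(q))`. … let `M(q)` be the set of positive integers which are composed of prime factors of `q`. Then
  `L(1,f) = 0` if and only if `Σ_{m∈M(q)} f(am)/m = 0` for every `a` with `1 ≤ a < q`, `(a,q) = 1`, and
  `Σ_{(r,q)>1} f(r)ε(r,p) = 0` for every prime divisor `p` of `q`»; **Theorem 3** «`L(1,f) = 0` if and only if
  `Σ_{b∈M(q)} f(ab)/b = 0` for every `a` with `1 ≤ a < q`, `(a,q) = 1`, and `Σ_{b∈M(q)} ((f_b,χ₀)/b) log b = 0`,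
  where `χ₀` is the principal Dirichlet character mod `q` and `f_b(a) = f(ab)`» (`f` rational-valued with
  `Σ_{a=1}^{q} f(a) = 0`, `(f,g) = φ(q)⁻¹ Σ_{(a,q)=1} f(a) ḡ(a)`); **Corollary 1**; **Theorem 2**; §4 (proof of
  Theorem 3, READ) and §5 (Theorem 4: the two second conditions agree — NOT re-derived here);
* T. Okada, *On a certain infinite series for a periodic arithmetical function*, Acta Arith. **40** (1982) 143–153
  [Okada1982] — the tree's scan is image-only; the statement is taken from [ChatterjeeMurty2014] Prop. 2 and from
  R. Tijdeman, *Some applications of Diophantine approximation* (Number Theory for the Millennium III, 2002)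
  [Tijdeman2002], Appendix, Theorem 8 (READ), where the first condition appears in the finite form (5.4)
  (`Σ_{m∈M(q)} f(am)/m = f(a) + Σ_{d∣q,1<d<q} Π_{p∈P(d)}(1 − p^{−φ(q)})⁻¹ Σ_{n∈S(d)} f(adn)/(dn) + f(q)/φ(q)`).

## What is proved (`N ≥ 1`; `M(N)` = `Nat.factoredNumbers N.primeFactors`; `χ₀ = (1 : DirichletCharacter ℂ N)`;
`L(1,f)` = Mathlib's `ZMod.LFunction f 1`, `= Σ_{n≥1} f(n)/n` for zero-sum `f` by P1 g53's Thm 22.3)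

* `sum_units_twist` — the unit sums `S(m) = Σ_{j unit} f(mj)` are twist-invariant;
* `sum_char_mul_eq_zero_of_digamma_sums_const` — THE CHARACTER STEP with a constant: if `g` lives on the units and
  `Σ_{a=1}^{N} g(ua)ψ(a/N)` does not depend on the unit `u`, every non-principal character sum of `g` vanishes
  (`Σ_a χ̄(a)ψ(a/N) = −N·L(1,χ̄) ≠ 0`, Murty–Rath Thm 22.4 + Dirichlet);
* **`okada_conditions_of_LFunction_one_eq_zero`** (necessity, `f : ℤ/N → ℚ`),
  **`LFunction_one_eq_zero_of_okada_conditions`** (sufficiency, any `f : ℤ/N → ℂ`),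
  **`LFunction_one_eq_zero_iff`** = OKADA'S CRITERION / Theorem 3, **`tendsto_sum_div_zero_iff`** (series form,
  no convergence hypothesis), `LFunction_one_eq_zero_iff_twists` (Corollary 1),
  `LFunction_one_eq_zero_iff_even_odd` (Theorem 2).

Faithfulness: the FIRST condition is typed exactly as printed in Prop. 2 / Thm 3 (the absolutely convergent sum
over `M(q)`); the SECOND in Theorem 3's form `Σ_{b∈M(q)} ((f_b,χ₀)/b) log b = 0` (up to the factor `φ(q)`); its
equivalence with the `ε(r,p)`-form (Chatterjee–Murty Thm 4 / Lemma 1) is not typed in this file. The sequel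
`ErdosConjectureOkadaProofs.lean` draws Okada's corollary: Erdős's conjecture for `2φ(q) + 1 > q`.
HONEST FRAMING: a printed 1982/2014 criterion made a kernel theorem on the tree's proved Baker theorem; nothing here
concerns `ζ(5)`; Erdős's conjecture for composite `q ≡ 1 (mod 4)` with `2φ(q)+1 ≤ q` stays OPEN (not typed).
-/

noncomputable section

open Complex Finset Filter Topology
open Literature.NumberTheory.LFunctions.ChatterjeeMurty2014
open Literature.NumberTheory.LFunctions.PeriodicLSeries (sum_comp_unit_mul tendsto_sum_range_div
  not_tendsto_sum_range_div tendsto_sum_range_div_iff dirichletCharacter_LFunction_one_eq_neg_sum_mul_digamma)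

namespace Literature.NumberTheory.Transcendental

namespace OkadaCriterion

variable {N : ℕ} [NeZero N]

/-! ### The unit twists `f_c = f(c·)`: the two smooth sums are twist-covariant / invariant -/

/-- A function on the finite set `ℤ/N` is bounded by the sum of its norms. [folklore] -/
private theorem norm_le_sum_norm (g : ZMod N → ℂ) (c : ZMod N) : ‖g c‖ ≤ ∑ c' : ZMod N, ‖g c'‖ :=
  Finset.single_le_sum (f := fun c' => ‖g c'‖) (fun _ _ => norm_nonneg _) (Finset.mem_univ c)

/-- `Σ_{j unit} f(c·m·j) = Σ_{j unit} f(m·j)` for a unit `c`: the unit sums `S(m) = Σ_j χ₀(j) f(mj)` — Chatterjee–Murty's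
`φ(q)(f_m, χ₀)` — are invariant under the twists `f ↦ f_c = f(c·)` («`(f_{cb}, χ) = χ(c)(f_b, χ)`» at
`χ = χ₀`). [cite: ChatterjeeMurty2014, §4 (proof of Theorem 3, display before (5))] -/
theorem sum_units_twist (Φ : ZMod N → ℂ) (c : (ZMod N)ˣ) (x : ZMod N) :
    ∑ j : ZMod N, (1 : DirichletCharacter ℂ N) j * Φ ((c : ZMod N) * (x * j)) =
      ∑ j : ZMod N, (1 : DirichletCharacter ℂ N) j * Φ (x * j) := by
  have h := sum_comp_unit_mul (fun j => (1 : DirichletCharacter ℂ N) j * Φ (x * j)) c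
  rw [← h]
  refine Finset.sum_congr rfl fun j _ => ?_
  rw [map_mul, MulChar.one_apply_coe, one_mul, mul_left_comm]

/-! ### Necessity: `L(1,f) = 0` forces Okada's conditions (Baker ⇒ transport ⇒ characters) -/

/-- **The character step.** Let `g : ℤ/N → ℂ` vanish off the units and suppose the «twisted digamma sums»
`Σ_{a=1}^{N} g(ua) ψ(a/N)` take the same value `Λ` for every unit `u`. Then every non-principal character sum of
`g` vanishes: `Σ_x χ(x) g(x)·Σ_{a=1}^{N} χ̄(a)ψ(a/N) = Σ_u χ(u)·Λ = 0` and `Σ_a χ̄(a)ψ(a/N) = −N·L(1,χ̄) ≠ 0`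
(«`Σ_{(c,q)=1} ψ̄(c) L(s,f_c) = φ(q) Σ_{b∈M(q)} ((f_b,ψ)/b^s) L(s,ψ)` … `since L(1,ψ) ≠ 0 by a celebrated theorem
of Dirichlet»). [cite: ChatterjeeMurty2014, §4 (proof of Theorem 3, display (9))] -/
theorem sum_char_mul_eq_zero_of_digamma_sums_const (g : ZMod N → ℂ) (hsupp : ∀ x : ZMod N, ¬ IsUnit x → g x = 0)
    (Λ : ℂ) (hconst : ∀ u : (ZMod N)ˣ,
      ∑ a ∈ Icc 1 N, g ((u : ZMod N) * (a : ZMod N)) * Complex.digamma ((a : ℂ) / N) = Λ)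
    {χ : DirichletCharacter ℂ N} (hχ : χ ≠ 1) : ∑ x : ZMod N, χ x * g x = 0 := by
  -- the twisted average `Σ_x χ(x) g(x a) = χ⁻¹(a) · Σ_x χ(x) g(x)`
  have htw : ∀ a : ZMod N, ∑ x : ZMod N, χ x * g (x * a) = χ⁻¹ a * ∑ x : ZMod N, χ x * g x := by
    intro a
    by_cases ha : IsUnit a
    · obtain ⟨w, rfl⟩ := ha
      have hinv : χ⁻¹ (w : ZMod N) = χ ((w⁻¹ : (ZMod N)ˣ) : ZMod N) := by
        rw [MulChar.inv_apply, Ring.inverse_unit]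
      have hww : χ (w : ZMod N) * χ ((w⁻¹ : (ZMod N)ˣ) : ZMod N) = 1 := by
        rw [← map_mul, Units.mul_inv, map_one]
      rw [hinv, Finset.mul_sum]
      refine Fintype.sum_equiv w.mulRight _ _ fun x => ?_
      show χ x * g (x * (w : ZMod N)) =
        χ ((w⁻¹ : (ZMod N)ˣ) : ZMod N) * (χ (x * (w : ZMod N)) * g (x * (w : ZMod N)))
      rw [map_mul]
      linear_combination (-(χ x * g (x * (w : ZMod N)))) * hww
    · rw [MulChar.map_nonunit _ ha, zero_mul]
      refine Finset.sum_eq_zero fun x _ => ?_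
      by_cases hx : IsUnit x
      · have h2 : ¬ IsUnit (x * a) := fun h => ha (isUnit_of_mul_isUnit_right h)
        rw [hsupp _ h2, mul_zero]
      · rw [MulChar.map_nonunit _ hx, zero_mul]
  -- sum the constant digamma sums against `χ`
  have hsum : ∑ x : ZMod N, χ x * ∑ a ∈ Icc 1 N, g (x * (a : ZMod N)) * Complex.digamma ((a : ℂ) / N) = 0 := by
    have h1 : ∀ x : ZMod N, χ x * ∑ a ∈ Icc 1 N, g (x * (a : ZMod N)) * Complex.digamma ((a : ℂ) / N) =
        χ x * Λ := by
      intro x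
      by_cases hx : IsUnit x
      · obtain ⟨u, rfl⟩ := hx
        rw [hconst u]
      · rw [MulChar.map_nonunit _ hx, zero_mul, zero_mul]
    rw [Finset.sum_congr rfl fun x _ => h1 x, ← Finset.sum_mul, MulChar.sum_eq_zero_of_ne_one hχ, zero_mul]
  -- reorganise: `(Σ_x χ(x) g(x)) · Σ_a χ⁻¹(a) ψ(a/N) = 0`
  have hsum' : (∑ x : ZMod N, χ x * g x) *
      ∑ a ∈ Icc 1 N, χ⁻¹ (a : ZMod N) * Complex.digamma ((a : ℂ) / N) = 0 := by
    rw [← hsum, Finset.mul_sum]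
    simp_rw [Finset.mul_sum]
    rw [Finset.sum_comm]
    refine Finset.sum_congr rfl fun a _ => ?_
    have h2 : ∑ x : ZMod N, χ x * (g (x * (a : ZMod N)) * Complex.digamma ((a : ℂ) / N)) =
        (∑ x : ZMod N, χ x * g (x * (a : ZMod N))) * Complex.digamma ((a : ℂ) / N) := by
      rw [Finset.sum_mul]
      exact Finset.sum_congr rfl fun x _ => by ring
    rw [h2, htw]
    ring
  -- `Σ_{a=1}^{N} χ⁻¹(a) ψ(a/N) = −N · L(1, χ⁻¹) ≠ 0`
  have hχ' : χ⁻¹ ≠ 1 := inv_ne_one.mpr hχ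
  have hN : (N : ℂ) ≠ 0 := by exact_mod_cast NeZero.ne N
  have hL : ∑ a ∈ Icc 1 N, χ⁻¹ (a : ZMod N) * Complex.digamma ((a : ℂ) / N) = -(N : ℂ) * χ⁻¹.LFunction 1 := by
    rw [dirichletCharacter_LFunction_one_eq_neg_sum_mul_digamma hχ', Finset.range_eq_Ico,
      Finset.sum_Ico_add' (fun a : ℕ => χ⁻¹ (a : ZMod N) * Complex.digamma ((a : ℂ) / N)) 0 N 1, zero_add,
      Finset.Ico_add_one_right_eq_Icc]
    field_simp
  have hne : ∑ a ∈ Icc 1 N, χ⁻¹ (a : ZMod N) * Complex.digamma ((a : ℂ) / N) ≠ 0 := by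
    rw [hL]
    exact mul_ne_zero (neg_ne_zero.mpr hN) (DirichletCharacter.LFunction_apply_one_ne_zero hχ')
  exact (mul_eq_zero.mp hsum').resolve_right hne


/-- `χ₀(x)·χ₀(x) = χ₀(x)` for the principal character (an indicator). [folklore] -/
private theorem one_apply_mul_self (x : ZMod N) :
    (1 : DirichletCharacter ℂ N) x * (1 : DirichletCharacter ℂ N) x = (1 : DirichletCharacter ℂ N) x := by
  by_cases hx : IsUnit x
  · rw [MulChar.one_apply hx, mul_one]
  · rw [MulChar.map_nonunit _ hx, mul_zero]

/-- **Okada's criterion, necessity** (Chatterjee–Murty 2014, Theorem 3 «only if»; Okada 1982). Let `f : ℤ/N → ℚ`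
have `Σ_j f(j) = 0` and `L(1,f) = Σ_{n≥1} f(n)/n = 0`. Then
(i) `Σ_{m∈M(N)} f(am)/m = 0` for every unit `a` of `ℤ/N`, and
(ii) `Σ_{m∈M(N)} (log m/m)·Σ_{j unit} f(mj) = 0`
(`M(N)` = the positive integers composed of primes dividing `N`). Route (§3 Cor 1 + §4): Baker's theorem makes
every unit twist vanish, `L(1, f(c·)) = 0` (P1 g55's `LFunction_one_twist_eq_zero` + `dft_relation_transport_unit`);
the smooth decomposition (`ChatterjeeMurty2014.LFunction_one_eq_sum_digamma_mul_tsum`) turns these into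
«`Σ_{a=1}^{N} g(ca)ψ(a/N)` is independent of `c`» for `g = χ₀·G`, `G(a) = Σ_{m∈M(N)} f(am)/m`; the character step
(`L(1,χ̄) ≠ 0`) and orthogonality make `g` constant on the units, and display (6) (`Σ_x g(x) = 0`) makes it zero.
[cite: ChatterjeeMurty2014, Theorem 3 and Proposition 2] [cite: Okada1982, Theorem (cf. Tijdeman2002, Appendix, Theorem 8)] -/
theorem okada_conditions_of_LFunction_one_eq_zero (f : ZMod N → ℚ)
    (hf : ∑ j : ZMod N, ((f j : ℚ) : ℂ) = 0) (h0 : ZMod.LFunction (fun j => ((f j : ℚ) : ℂ)) 1 = 0) :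
    (∀ a : ZMod N, IsUnit a →
      ∑' m : Nat.factoredNumbers N.primeFactors, ((f ((m : ℕ) * a) : ℚ) : ℂ) / ((m : ℕ) : ℂ) = 0) ∧
    ∑' m : Nat.factoredNumbers N.primeFactors, Complex.log ((m : ℕ) : ℂ) *
      (∑ j : ZMod N, (1 : DirichletCharacter ℂ N) j * ((f ((m : ℕ) * j) : ℚ) : ℂ)) / ((m : ℕ) : ℂ) = 0 := by
  set Φ : ZMod N → ℂ := fun j => ((f j : ℚ) : ℂ) with hΦ
  set G : ZMod N → ℂ := fun x =>
    ∑' m : Nat.factoredNumbers N.primeFactors, Φ ((m : ℕ) * x) / ((m : ℕ) : ℂ) with hG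
  set Λ : ℂ := ∑' m : Nat.factoredNumbers N.primeFactors, Complex.log ((m : ℕ) : ℂ) *
      (∑ j : ZMod N, (1 : DirichletCharacter ℂ N) j * Φ ((m : ℕ) * j)) / ((m : ℕ) : ℂ) with hΛ
  set g : ZMod N → ℂ := fun x => (1 : DirichletCharacter ℂ N) x * G x with hg
  have hN : (N : ℂ) ≠ 0 := by exact_mod_cast NeZero.ne N
  have hgsupp : ∀ x : ZMod N, ¬ IsUnit x → g x = 0 := fun x hx => by
    simp only [hg, MulChar.map_nonunit _ hx, zero_mul]
  -- Baker + Galois transport: every unit twist vanishes at `s = 1`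
  have halg : ∀ j, IsAlgebraic ℚ (Φ j) := fun j => isAlgebraic_algebraMap (f j)
  have htw : ∀ u : (ZMod N)ˣ, ZMod.LFunction (fun j => Φ ((u : ZMod N) * j)) 1 = 0 := fun u =>
    BakerBirchWirsing.LFunction_one_twist_eq_zero Φ halg hf
      (fun r hr v => BakerBirchWirsing.dft_relation_transport_unit f r hr v) h0 u
  -- the smooth decomposition of each twist: `Σ_a g(ua) ψ(a/N) = −Λ`
  have hE : ∀ u : (ZMod N)ˣ,
      ∑ a ∈ Icc 1 N, g ((u : ZMod N) * (a : ZMod N)) * Complex.digamma ((a : ℂ) / N) = -Λ := by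
    intro u
    have hfu : ∑ j : ZMod N, Φ ((u : ZMod N) * j) = 0 := by rw [sum_comp_unit_mul Φ u]; exact hf
    have h := LFunction_one_eq_sum_digamma_mul_tsum (fun j => Φ ((u : ZMod N) * j)) hfu
    rw [htw u, mul_zero] at h
    have h1 : ∀ a : ℕ, ∑' m : Nat.factoredNumbers N.primeFactors,
        Φ ((u : ZMod N) * ((m : ℕ) * (a : ZMod N))) / ((m : ℕ) : ℂ) = G ((u : ZMod N) * (a : ZMod N)) := by
      intro a
      simp only [hG]
      exact tsum_congr fun m => by rw [mul_left_comm]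
    have h2 : ∀ m : Nat.factoredNumbers N.primeFactors,
        (∑ j : ZMod N, (1 : DirichletCharacter ℂ N) j * Φ ((u : ZMod N) * ((m : ℕ) * j))) =
          ∑ j : ZMod N, (1 : DirichletCharacter ℂ N) j * Φ ((m : ℕ) * j) :=
      fun m => sum_units_twist Φ u _
    simp_rw [h1, h2] at h
    have h3 : ∀ a ∈ Icc 1 N, (1 : DirichletCharacter ℂ N) (a : ZMod N) * Complex.digamma ((a : ℂ) / N) *
        G ((u : ZMod N) * (a : ZMod N)) =
        g ((u : ZMod N) * (a : ZMod N)) * Complex.digamma ((a : ℂ) / N) := by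
      intro a _
      simp only [hg, map_mul, MulChar.one_apply_coe, one_mul]
      ring
    rw [Finset.sum_congr rfl h3, ← hΛ] at h
    linear_combination h
  -- the character step and orthogonality: `g` is constant on the units …
  have hchar : ∀ χ : DirichletCharacter ℂ N, χ ≠ 1 → ∑ x : ZMod N, χ x * g x = 0 := fun χ hχ =>
    sum_char_mul_eq_zero_of_digamma_sums_const g hgsupp (-Λ) hE hχ
  -- … and has total sum zero (display (6)), hence vanishes
  have hsumg : ∑ x : ZMod N, g x = 0 := by
    have h6 := tsum_sum_units_div_eq_zero Φ hf
    have hsw : ∑' m : Nat.factoredNumbers N.primeFactors,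
        (∑ j : ZMod N, (1 : DirichletCharacter ℂ N) j * Φ ((m : ℕ) * j)) / ((m : ℕ) : ℂ) =
        ∑ j : ZMod N, g j := by
      simp_rw [Finset.sum_div]
      rw [Summable.tsum_finsetSum (fun j _ => ?_)]
      · refine Finset.sum_congr rfl fun j _ => ?_
        simp only [hg, hG, ← tsum_mul_left]
        exact tsum_congr fun m => by ring
      · simp_rw [mul_div_assoc]
        exact (summable_factoredNumbers_div (c := fun n : ℕ => Φ ((n : ZMod N) * j))
          (fun n => norm_le_sum_norm (fun c : ZMod N => Φ (c * j)) n)).mul_left _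
    rw [← hsw, h6]
  have hg0 : ∀ u : (ZMod N)ˣ, g u = 0 := by
    intro u
    have htot := BakerBirchWirsing.totient_mul_apply_eq g hchar u
    have h1 : ∑ j : ZMod N, (1 : DirichletCharacter ℂ N) j * g j = ∑ j : ZMod N, g j :=
      Finset.sum_congr rfl fun j _ => by simp only [hg, ← mul_assoc, one_apply_mul_self]
    rw [h1, hsumg] at htot
    have hφ : (N.totient : ℂ) ≠ 0 := by exact_mod_cast (Nat.totient_pos.mpr (NeZero.pos N)).ne'
    exact (mul_eq_zero.mp htot).resolve_left hφ
  have hG0 : ∀ a : ZMod N, IsUnit a → G a = 0 := by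
    intro a ha
    obtain ⟨u, rfl⟩ := ha
    have h := hg0 u
    simp only [hg, MulChar.one_apply_coe, one_mul] at h
    exact h
  refine ⟨fun a ha => hG0 a ha, ?_⟩
  -- (ii): `Λ = −Σ_a g(a) ψ(a/N) = 0`
  have h1 := hE 1
  rw [Units.val_one] at h1
  have hz : ∑ a ∈ Icc 1 N, g (1 * (a : ZMod N)) * Complex.digamma ((a : ℂ) / N) = 0 := by
    refine Finset.sum_eq_zero fun a _ => ?_
    rw [one_mul]
    by_cases ha : IsUnit (a : ZMod N)
    · rw [show g (a : ZMod N) = 0 by simp only [hg, hG0 _ ha, mul_zero], zero_mul]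
    · rw [hgsupp _ ha, zero_mul]
  rw [hz] at h1
  exact neg_eq_zero.mp h1.symm


/-! ### Sufficiency and the criterion -/

/-- **Okada's criterion, sufficiency** («The if part is also clear from (6) and the immediate predecessor equation
of (6)»): for ANY `f : ℤ/N → ℂ` with `Σ_j f(j) = 0`, if `Σ_{m∈M(N)} f(am)/m = 0` for every unit `a` and
`Σ_{m∈M(N)} (log m/m) Σ_{j unit} f(mj) = 0`, then `L(1,f) = 0` — immediate from
`N·L(1,f) = −Σ_a χ₀(a)ψ(a/N)G(a) − Σ_m (log m/m)S(m)`. [cite: ChatterjeeMurty2014, Theorem 3 («if»)] -/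
theorem LFunction_one_eq_zero_of_okada_conditions (Φ : ZMod N → ℂ) (hΦ : ∑ j : ZMod N, Φ j = 0)
    (hG : ∀ a : ZMod N, IsUnit a →
      ∑' m : Nat.factoredNumbers N.primeFactors, Φ ((m : ℕ) * a) / ((m : ℕ) : ℂ) = 0)
    (hΛ : ∑' m : Nat.factoredNumbers N.primeFactors, Complex.log ((m : ℕ) : ℂ) *
      (∑ j : ZMod N, (1 : DirichletCharacter ℂ N) j * Φ ((m : ℕ) * j)) / ((m : ℕ) : ℂ) = 0) :
    ZMod.LFunction Φ 1 = 0 := by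
  have hN : (N : ℂ) ≠ 0 := by exact_mod_cast NeZero.ne N
  have h := LFunction_one_eq_sum_digamma_mul_tsum Φ hΦ
  have hz : ∑ a ∈ Icc 1 N, (1 : DirichletCharacter ℂ N) (a : ZMod N) * Complex.digamma ((a : ℂ) / N) *
      ∑' m : Nat.factoredNumbers N.primeFactors, Φ ((m : ℕ) * (a : ZMod N)) / ((m : ℕ) : ℂ) = 0 := by
    refine Finset.sum_eq_zero fun a _ => ?_
    by_cases ha : IsUnit (a : ZMod N)
    · rw [hG _ ha, mul_zero]
    · rw [MulChar.map_nonunit _ ha, zero_mul, zero_mul]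
  rw [hz, hΛ, neg_zero, sub_zero] at h
  exact (mul_eq_zero.mp h).resolve_left hN

/-- **OKADA'S CRITERION** (Okada 1982; in the Dirichlet-series form of Chatterjee–Murty 2014, Theorem 3 /
Proposition 2 «Let `M(q)` be the set of positive integers which are composed of prime factors of `q`. Then
`L(1,f) = 0` if and only if `Σ_{m∈M(q)} f(am)/m = 0` for every `a` with `1 ≤ a < q`, `(a,q) = 1`, and
`Σ_{b∈M(q)} ((f_b,χ₀)/b) log b = 0`»; the second condition is Okada's / Saradha–Tijdeman's
`Σ_{(r,q)>1} f(r)ε(r,p) = 0` for every `p ∣ q` by Chatterjee–Murty's Theorem 4, not re-derived here). For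
`f : ℤ/N → ℚ` with `Σ_j f(j) = 0` (so that `Σ f(n)/n` converges, to `L(1,f)`):
`L(1,f) = 0 ⟺ [∀ units a, Σ_{m∈M(N)} f(am)/m = 0] ∧ Σ_{m∈M(N)} (log m/m)·Σ_{j unit} f(mj) = 0`.
The rational case is the printed hypothesis «`Φ_q` irreducible over `ℚ(f(1),…,f(q))`» with `F = ℚ`.
[cite: ChatterjeeMurty2014, Theorem 3 and Proposition 2] [cite: Okada1982, Theorem (cf. Tijdeman2002, Appendix, Theorem 8)] -/
theorem LFunction_one_eq_zero_iff (f : ZMod N → ℚ) (hf : ∑ j : ZMod N, ((f j : ℚ) : ℂ) = 0) :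
    ZMod.LFunction (fun j => ((f j : ℚ) : ℂ)) 1 = 0 ↔
      (∀ a : ZMod N, IsUnit a →
        ∑' m : Nat.factoredNumbers N.primeFactors, ((f ((m : ℕ) * a) : ℚ) : ℂ) / ((m : ℕ) : ℂ) = 0) ∧
      ∑' m : Nat.factoredNumbers N.primeFactors, Complex.log ((m : ℕ) : ℂ) *
        (∑ j : ZMod N, (1 : DirichletCharacter ℂ N) j * ((f ((m : ℕ) * j) : ℚ) : ℂ)) / ((m : ℕ) : ℂ) = 0 :=
  ⟨okada_conditions_of_LFunction_one_eq_zero f hf,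
    fun h => LFunction_one_eq_zero_of_okada_conditions (fun j => ((f j : ℚ) : ℂ)) hf h.1 h.2⟩

/-- **Okada's criterion, series form, no convergence hypothesis**: for `f : ℤ/N → ℚ` the partial sums
`Σ_{n≤M} f(n)/n` tend to `0` iff `Σ_j f(j) = 0` (convergence, Murty–Rath Thm 22.3 — P1 g53's
`PeriodicLSeries.tendsto_sum_range_div_iff`), `Σ_{m∈M(N)} f(am)/m = 0` for every unit `a`, and
`Σ_{m∈M(N)} (log m/m) Σ_{j unit} f(mj) = 0`. [cite: ChatterjeeMurty2014, Theorem 3] [cite: Okada1982, Theorem] -/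
theorem tendsto_sum_div_zero_iff (f : ZMod N → ℚ) :
    Tendsto (fun M : ℕ => ∑ n ∈ range M, ((f ((n + 1 : ℕ) : ZMod N) : ℚ) : ℂ) / ((n + 1 : ℕ) : ℂ))
        atTop (𝓝 0) ↔
      ∑ j : ZMod N, ((f j : ℚ) : ℂ) = 0 ∧
      (∀ a : ZMod N, IsUnit a →
        ∑' m : Nat.factoredNumbers N.primeFactors, ((f ((m : ℕ) * a) : ℚ) : ℂ) / ((m : ℕ) : ℂ) = 0) ∧
      ∑' m : Nat.factoredNumbers N.primeFactors, Complex.log ((m : ℕ) : ℂ) *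
        (∑ j : ZMod N, (1 : DirichletCharacter ℂ N) j * ((f ((m : ℕ) * j) : ℚ) : ℂ)) / ((m : ℕ) : ℂ) = 0 := by
  constructor
  · intro h
    have hf : ∑ j : ZMod N, ((f j : ℚ) : ℂ) = 0 :=
      (tendsto_sum_range_div_iff (fun j => ((f j : ℚ) : ℂ))).mp ⟨0, h⟩
    have h0 : ZMod.LFunction (fun j => ((f j : ℚ) : ℂ)) 1 = 0 :=
      (Literature.NumberTheory.LFunctions.PeriodicLSeries.eq_LFunction_one_of_tendsto
        (fun j => ((f j : ℚ) : ℂ)) h).symm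
    exact ⟨hf, (LFunction_one_eq_zero_iff f hf).mp h0⟩
  · rintro ⟨hf, hG, hΛ⟩
    have h0 := (LFunction_one_eq_zero_iff f hf).mpr ⟨hG, hΛ⟩
    rw [← h0]
    exact tendsto_sum_range_div (fun j => ((f j : ℚ) : ℂ)) hf

/-- **Chatterjee–Murty 2014, Corollary 1**: «`L(1,f) = 0` if and only if `L(1,f_a) = 0` for any `1 ≤ a < q`
with `(a,q) = 1`», `f_a(b) = f(ab)`, for rational-valued zero-sum `f` (⇒ is the Galois transport after Baker's
theorem, P1 g55's `LFunction_one_twist_eq_zero`; ⇐ is `a = 1`). [cite: ChatterjeeMurty2014, Corollary 1] -/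
theorem LFunction_one_eq_zero_iff_twists (f : ZMod N → ℚ) (hf : ∑ j : ZMod N, ((f j : ℚ) : ℂ) = 0) :
    ZMod.LFunction (fun j => ((f j : ℚ) : ℂ)) 1 = 0 ↔
      ∀ u : (ZMod N)ˣ, ZMod.LFunction (fun j => ((f ((u : ZMod N) * j) : ℚ) : ℂ)) 1 = 0 := by
  constructor
  · intro h0 u
    exact BakerBirchWirsing.LFunction_one_twist_eq_zero (fun j => ((f j : ℚ) : ℂ))
      (fun j => isAlgebraic_algebraMap (f j)) hf
      (fun r hr v => BakerBirchWirsing.dft_relation_transport_unit f r hr v) h0 u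
  · intro h
    simpa only [Units.val_one, one_mul] using h 1

/-- Linearity of `ZMod.LFunction` in the coefficient function (two terms). [folklore] -/
private theorem LFunction_linear (c d : ℂ) (Φ Ψ : ZMod N → ℂ) (s : ℂ) :
    ZMod.LFunction (fun j => c * Φ j + d * Ψ j) s = c * ZMod.LFunction Φ s + d * ZMod.LFunction Ψ s := by
  simp only [ZMod.LFunction, add_mul, Finset.sum_add_distrib, mul_add, Finset.mul_sum]
  congr 1 <;> exact Finset.sum_congr rfl fun j _ => by ring

/-- **Chatterjee–Murty 2014, Theorem 2**: «`L(1,f) = 0` if and only if `L(1,f_e) = 0` and `L(1,f_o) = 0`, where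
`f_e` and `f_o` are the even and odd part of `f`» (`f_e = (f + f₋)/2`, `f_o = (f − f₋)/2`, `f₋(x) = f(−x)`;
Corollary 1 at `a = −1`), for rational-valued zero-sum `f`. [cite: ChatterjeeMurty2014, Theorem 2] -/
theorem LFunction_one_eq_zero_iff_even_odd (f : ZMod N → ℚ) (hf : ∑ j : ZMod N, ((f j : ℚ) : ℂ) = 0) :
    ZMod.LFunction (fun j => ((f j : ℚ) : ℂ)) 1 = 0 ↔
      ZMod.LFunction (fun j => (((f j : ℚ) : ℂ) + ((f (-j) : ℚ) : ℂ)) / 2) 1 = 0 ∧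
        ZMod.LFunction (fun j => (((f j : ℚ) : ℂ) - ((f (-j) : ℚ) : ℂ)) / 2) 1 = 0 := by
  have he : (fun j : ZMod N => (((f j : ℚ) : ℂ) + ((f (-j) : ℚ) : ℂ)) / 2) =
      fun j => (1 / 2 : ℂ) * ((f j : ℚ) : ℂ) + (1 / 2 : ℂ) * ((f (-j) : ℚ) : ℂ) := by
    funext j; ring
  have ho : (fun j : ZMod N => (((f j : ℚ) : ℂ) - ((f (-j) : ℚ) : ℂ)) / 2) =
      fun j => (1 / 2 : ℂ) * ((f j : ℚ) : ℂ) + (-(1 / 2) : ℂ) * ((f (-j) : ℚ) : ℂ) := by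
    funext j; ring
  rw [he, ho, LFunction_linear, LFunction_linear]
  constructor
  · intro h0
    have hm : ZMod.LFunction (fun j => ((f (-j) : ℚ) : ℂ)) 1 = 0 := by
      have h := (LFunction_one_eq_zero_iff_twists f hf).mp h0 (-1)
      simpa only [Units.val_neg, Units.val_one, neg_one_mul] using h
    rw [h0, hm]
    constructor <;> ring
  · rintro ⟨h1, h2⟩
    linear_combination h1 + h2

end OkadaCriterion

end Literature.NumberTheory.Transcendental

end
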